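import Summits.CriticalPhenomena.PercolationContinuityZ3.Theses.PercLowPointHalfSpace
import Summits.CriticalPhenomena.PercolationContinuityZ3.Theorems.PercLowPointHalfSpaceTallClusterMassBoundArrowOneThreshold
import Summits.CriticalPhenomena.PercolationContinuityZ3.Theorems.PercLowPointHalfSpaceTallClusterMassBoundWallArmPartial
import Mathlib.Analysis.SpecialFunctions.Pow.Asymptotics

/-!
# `TallClusterMassBound` (stmt-CriticalPhenomena-0912), line `onesided-halves` — the sorry-free GLUE

Crux B = `Summit.CriticalPhenomena.PercolationContinuityZ3.Theses.PercLowPointHalfSpace.TallClusterMassBound`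
(`MassBoundAt p_c (11/4)`: conditional mass of tall critical half-space clusters `≤ C r^{11/4} π_s(r)`).
This file is the Theorems-side copy of every sorry-free declaration of the registered skeleton
`Cruxes/TallClusterMassBound/Lines/onesided_halves.lean` (rev 2, crux-strategist 2026-08-17; stubs
`stub_noFatHalfBoxOrigin` (B♯), `stub_typicalMaxPolyGrowth` (G), `stub_wallArmPolyRegular` (D)), landed so that the
line's composition is importable and the prepared route split of B can cite a landed glue declaration (`--glue-by`).

The cut is by the DIRECTION OF CRITICALITY each piece uses:
* B♯ (`p ≤ p_c` only; false at `p = 1`): `P^ℍ_{p_c}(|K_max(B_n ∩ ℍ)| ≥ C n^{11/4}) ≤ e^{-1}` — the typical largest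
  cluster trace of induced half-space percolation in `Λ_n` is `≤ C n^{11/4}`; ⟸ stmt-CriticalPhenomena-11506 (p136366).
* G (`p ≥ p_c`-type, exponent-free): `c (r/ρ)^κ · typicalMax Λ_ρ ≤ typicalMax Λ_r`, `1 ≤ ρ ≤ r`, SOME `c, κ > 0`.
* D (`p ≥ p_c`-type, exponent-free): `π_s(ρ) ≤ C (r/ρ)^μ π_s(r)`, `1 ≤ ρ ≤ r`, SOME `C, μ` (⟺ uniform wall-arm
  doubling `π_s(2n) ≥ q₀ π_s(n)` for SOME `q₀ > 0`).

Contents (all sorry-free; `P^ℍ = floorDilutedPercolation 3 p_c 1`, `Λ_r = halfBox r`, `π_s = armProb p_c`):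
* `typicalMax_le_of_noFat` — B♯ ⟹ `typicalMax P^ℍ Λ_r ≤ (C+1) r^{11/4}`;
* `exists_bandRatio` — analytic choice of a band ratio `L` (exponential beats polynomial);
* `volTail_band_step` — one step across the band ratio: off the arm event at scale `ρ = ⌊r/L⌋` the wall cluster is
  confined to `Λ_ρ`, where volume `≥ typicalMax Λ_r ≥ c L^κ typicalMax Λ_ρ` (G) costs `e^{-⌊(cL^κ-1)/2⌋}` by Hutchcroft's
  ROOTED universal tightness (`TightnessLine.real_mul_threshold_le_clusterCapIn_le`); the arm costs `π_s(ρ) ≤ C(2L)^μ π_s(r)` (D);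
* `wallVolumeRadiusRatio_of_growth_of_regular` — **V ⟸ G ∧ D**: the wall VOLUME/RADIUS ratio bound
  `P^ℍ_{p_c}(|C_ℍ(0)| ≥ typicalMax Λ_r) ≤ K π_s(r)` for all `r ≥ 1` (strong induction on `r`; small scales by the floor
  `π_s(r) ≥ 1/(588 r²)`);
* `tallClusterMassBound_of_noFat_of_volRad` — **B ⟸ B♯ ∧ V** (ARROW 1 in root-ratio form,
  `TightnessLine.massBoundAt_of_typicalMax_le_of_rootRatio`, p130878), hypotheses in ROUTE vocabulary (Literature constants
  only) = the children `NoFatHalfBoxOrigin`, `WallVolumeRadiusRatio` of the prepared k = 2 split;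
* `tallClusterMassBound_of_noFat_of_growth_of_regular` — **B ⟸ B♯ ∧ G ∧ D**, hypotheses = the three registered stubs
  verbatim (= the skeleton's `TallClusterMassBound_of`);
* `tallClusterMassBound_of_noFat_of_growth_of_regular_route` — the same with G and D spelled in ROUTE vocabulary
  (`typicalMax … ((box 3 r).filter (0 ≤ ·₀))`, `(bondPercolation (zdGraph 3) p_c).real {arm_ℍ(0,r)}`) = the children
  `NoFatHalfBoxOrigin`, `TypicalMaxPolyGrowth`, `WallArmPolyRegular` of the prepared k = 3 split (definitional unfolding only).
Nothing here uses criticality beyond `armProb_criticalProbI_pos` / `armProb_criticalProbI_ge` (both proved floors); no definitions.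
The three stubs themselves are NOT proved here (open, crux-sized).
-/

noncomputable section

open MeasureTheory Finset Filter Topology
open Literature.Probability.Percolation Literature.Probability.LatticeModels
open Summit.CriticalPhenomena.PercolationContinuityZ3.Theses.PercLowPointHalfSpace (TallClusterMassBound)
open Summit.CriticalPhenomena.PercolationContinuityZ3.Theorems.TallClusterMassBound.Negative
open Summit.CriticalPhenomena.PercolationContinuityZ3.Theorems.TallClusterMassBound.TightnessLine
open Summit.CriticalPhenomena.PercolationContinuityZ3.Theorems.TallClusterMassBound.ReplicaOverlap (armProb_criticalProbI_ge)

namespace Summit.CriticalPhenomena.PercolationContinuityZ3.Theorems.TallClusterMassBound.OnesidedHalves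

/-! ## Glue, part 1: B♯ bounds the typical max -/

/-- **B♯ ⟹ `typicalMax ≤ (C+1) r^{11/4}`**: `⌈C r^{11/4}⌉` lies in the defining set of Hutchcroft's `1/e`-quantile
`typicalMax = min{n | P(|K_max(Λ_r)| ≥ n) ≤ e^{-1}}`. [folklore] -/
theorem typicalMax_le_of_noFat
    (h : ∃ C : ℝ, 0 < C ∧ ∀ n : ℕ, 1 ≤ n → (floorDilutedPercolation 3 (criticalProbI 3) 1).real
      {ω | C * (n : ℝ) ^ ((11 : ℝ) / 4) ≤ (clusterMaxIn ((box 3 n).filter fun z : Site 3 => 0 ≤ z 0) ω : ℝ)} ≤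
        Real.exp (-1)) :
    ∃ C : ℝ, ∀ r : ℕ, 1 ≤ r →
      (typicalMax (floorDilutedPercolation 3 (criticalProbI 3) 1) (halfBox r) : ℝ) ≤ C * (r : ℝ) ^ ((11 : ℝ) / 4) := by
  obtain ⟨C, hC, hfat⟩ := h
  refine ⟨C + 1, fun r hr => ?_⟩
  set μ := floorDilutedPercolation 3 (criticalProbI 3) 1
  have hr1 : (1 : ℝ) ≤ r := by exact_mod_cast hr
  have hR : 1 ≤ (r : ℝ) ^ ((11 : ℝ) / 4) := Real.one_le_rpow hr1 (by norm_num)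
  have hct0 : 0 ≤ C * (r : ℝ) ^ ((11 : ℝ) / 4) := by positivity
  set t : ℕ := ⌈C * (r : ℝ) ^ ((11 : ℝ) / 4)⌉₊ with ht
  have hmem : μ.real {ω | t ≤ clusterMaxIn (halfBox r) ω} ≤ Real.exp (-1) := by
    refine le_trans ?_ (hfat r hr)
    refine measureReal_mono ?_ (measure_ne_top _ _)
    intro ω hω
    have hω' : (t : ℝ) ≤ (clusterMaxIn (halfBox r) ω : ℝ) := by exact_mod_cast hω
    exact (Nat.le_ceil _).trans hω'
  have hle : typicalMax μ (halfBox r) ≤ t := Nat.sInf_le hmem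
  have hle' : (typicalMax μ (halfBox r) : ℝ) ≤ (t : ℝ) := by exact_mod_cast hle
  calc (typicalMax μ (halfBox r) : ℝ) ≤ t := hle'
    _ ≤ C * (r : ℝ) ^ ((11 : ℝ) / 4) + 1 := (Nat.ceil_lt_add_one hct0).le
    _ ≤ C * (r : ℝ) ^ ((11 : ℝ) / 4) + (r : ℝ) ^ ((11 : ℝ) / 4) := by linarith
    _ = (C + 1) * (r : ℝ) ^ ((11 : ℝ) / 4) := by ring

/-! ## Glue, part 2: V ⟸ G ∧ D (the wall volume/radius ratio from growth and regularity) -/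

/-! ### Analytic choice of the band ratio `L` -/

/-- For `c, κ > 0`, `C ≥ 0` and any real `μ` there is a scale ratio `L ≥ 2` with `c L^κ ≥ 1` and
`C (2L)^μ · exp(−⌊(cL^κ − 1)/2⌋) ≤ 1/2` (exponential beats polynomial). [folklore] -/
theorem exists_bandRatio {c κ C μ : ℝ} (hc : 0 < c) (hκ : 0 < κ) (hC : 0 ≤ C) :
    ∃ L : ℕ, 2 ≤ L ∧ 1 ≤ c * (L : ℝ) ^ κ ∧
      C * (2 * (L : ℝ)) ^ μ * Real.exp (-(⌊(c * (L : ℝ) ^ κ - 1) / 2⌋₊ : ℝ)) ≤ 1 / 2 := by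
  -- g(x) = x^{μ/κ} e^{-(c/2) x} → 0 as x → ∞, and L^κ → ∞ along ℕ
  have hg : Tendsto (fun x : ℝ => x ^ (μ / κ) * Real.exp (-(c / 2) * x)) atTop (𝓝 0) :=
    tendsto_rpow_mul_exp_neg_mul_atTop_nhds_zero (μ / κ) (c / 2) (by positivity)
  have hpow : Tendsto (fun L : ℕ => ((L : ℝ)) ^ κ) atTop atTop :=
    (tendsto_rpow_atTop hκ).comp tendsto_natCast_atTop_atTop
  have hcomp : Tendsto (fun L : ℕ => (((L : ℝ)) ^ κ) ^ (μ / κ) * Real.exp (-(c / 2) * ((L : ℝ) ^ κ))) atTop (𝓝 0) :=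
    hg.comp hpow
  set D : ℝ := C * (2 : ℝ) ^ μ * Real.exp (3 / 2) with hD
  have hD0 : 0 ≤ D := by positivity
  have hδ : (0 : ℝ) < 1 / (2 * (D + 1)) := by positivity
  have h1 : ∀ᶠ L : ℕ in atTop, (((L : ℝ)) ^ κ) ^ (μ / κ) * Real.exp (-(c / 2) * ((L : ℝ) ^ κ)) < 1 / (2 * (D + 1)) :=
    hcomp.eventually (gt_mem_nhds hδ)
  have h2 : ∀ᶠ L : ℕ in atTop, 1 ≤ c * (L : ℝ) ^ κ := by
    have : Tendsto (fun L : ℕ => c * (L : ℝ) ^ κ) atTop atTop := hpow.const_mul_atTop hc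
    exact this.eventually_ge_atTop 1
  have h3 : ∀ᶠ L : ℕ in atTop, 2 ≤ L := eventually_ge_atTop 2
  obtain ⟨L, hL1, hL2, hL3⟩ := (h1.and (h2.and h3)).exists
  refine ⟨L, hL3, hL2, ?_⟩
  have hL0 : (0 : ℝ) ≤ L := Nat.cast_nonneg _
  have hLpos : (0 : ℝ) < L := by exact_mod_cast (lt_of_lt_of_le (by norm_num) hL3)
  -- (L^κ)^{μ/κ} = L^μ
  have hpowid : (((L : ℝ)) ^ κ) ^ (μ / κ) = (L : ℝ) ^ μ := by
    rw [← Real.rpow_mul hL0, mul_div_cancel₀ μ hκ.ne']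
  rw [hpowid] at hL1
  -- the floor: exp(−⌊y⌋) ≤ exp(1 − y), y = (cL^κ − 1)/2 ≥ 0
  set y : ℝ := (c * (L : ℝ) ^ κ - 1) / 2 with hy
  have hy0 : 0 ≤ y := by rw [hy]; linarith
  have hfloor : y - 1 ≤ (⌊y⌋₊ : ℝ) := by
    have := Nat.sub_one_lt_floor y
    linarith
  have hexp : Real.exp (-(⌊y⌋₊ : ℝ)) ≤ Real.exp (3 / 2) * Real.exp (-(c / 2) * ((L : ℝ) ^ κ)) := by
    rw [← Real.exp_add]
    apply Real.exp_le_exp.2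
    have : -(⌊y⌋₊ : ℝ) ≤ 1 - y := by linarith
    refine this.trans (le_of_eq ?_)
    rw [hy]; ring
  have h2μ : (2 * (L : ℝ)) ^ μ = (2 : ℝ) ^ μ * (L : ℝ) ^ μ := Real.mul_rpow (by norm_num) hL0
  calc C * (2 * (L : ℝ)) ^ μ * Real.exp (-(⌊y⌋₊ : ℝ))
      ≤ C * (2 * (L : ℝ)) ^ μ * (Real.exp (3 / 2) * Real.exp (-(c / 2) * ((L : ℝ) ^ κ))) := by
        gcongr
    _ = D * ((L : ℝ) ^ μ * Real.exp (-(c / 2) * ((L : ℝ) ^ κ))) := by rw [h2μ, hD]; ring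
    _ ≤ D * (1 / (2 * (D + 1))) := mul_le_mul_of_nonneg_left hL1.le hD0
    _ ≤ 1 / 2 := by
        rw [mul_one_div, div_le_div_iff₀ (by positivity) (by norm_num)]
        nlinarith

/-! ### One step across the band ratio `L` -/

/-- **Band step.** Under (G) and (D) (with `C, μ ≥ 0`), for `L ≥ 2` with `c L^κ ≥ 1` and `r ≥ L`, `ρ = ⌊r/L⌋`:
`P^ℍ(|C_ℍ(0)| ≥ M_r) ≤ C (2L)^μ π_s(r) · (1 + e^{−⌊(cL^κ−1)/2⌋} · P^ℍ(|C_ℍ(0)| ≥ M_ρ)/π_s(ρ))` — off the arm event at scale `ρ`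
the cluster is confined to `Λ_ρ`, where volume `M_r ≥ c L^κ M_ρ` costs `e^{−N}` by ROOTED universal tightness; the arm at scale `ρ` costs
`π_s(ρ) ≤ C (2L)^μ π_s(r)`. [folklore] -/
theorem volTail_band_step {c κ C μ : ℝ} (hc : 0 < c) (hκ : 0 < κ) (hC : 0 ≤ C) (hμ : 0 ≤ μ)
    (hG : ∀ ρ r : ℕ, 1 ≤ ρ → ρ ≤ r →
      c * ((r : ℝ) / ρ) ^ κ * (typicalMax (floorDilutedPercolation 3 (criticalProbI 3) 1) (halfBox ρ) : ℝ) ≤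
        typicalMax (floorDilutedPercolation 3 (criticalProbI 3) 1) (halfBox r))
    (hD : ∀ ρ r : ℕ, 1 ≤ ρ → ρ ≤ r →
      armProb (criticalProbI 3) ρ ≤ C * ((r : ℝ) / ρ) ^ μ * armProb (criticalProbI 3) r)
    {L : ℕ} (hL : 2 ≤ L) (hcL : 1 ≤ c * (L : ℝ) ^ κ) {r : ℕ} (hr : L ≤ r) :
    (floorDilutedPercolation 3 (criticalProbI 3) 1).real
        (clusterSizeGe (0 : V3) (typicalMax (floorDilutedPercolation 3 (criticalProbI 3) 1) (halfBox r))) ≤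
      C * (2 * (L : ℝ)) ^ μ * armProb (criticalProbI 3) r *
        (1 + Real.exp (-(⌊(c * (L : ℝ) ^ κ - 1) / 2⌋₊ : ℝ)) *
          ((floorDilutedPercolation 3 (criticalProbI 3) 1).real
              (clusterSizeGe (0 : V3) (typicalMax (floorDilutedPercolation 3 (criticalProbI 3) 1) (halfBox (r / L)))) /
            armProb (criticalProbI 3) (r / L))) := by
  set P := floorDilutedPercolation 3 (criticalProbI 3) 1 with hP
  set ρ : ℕ := r / L with hρ
  set Mr : ℕ := typicalMax P (halfBox r) with hMr
  set Mρ : ℕ := typicalMax P (halfBox ρ) with hMρ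
  set N : ℕ := ⌊(c * (L : ℝ) ^ κ - 1) / 2⌋₊ with hN
  have hL0 : 0 < L := by omega
  have hr0 : 0 < r := by omega
  have hρ1 : 1 ≤ ρ := (Nat.div_pos hr hL0)
  have hρr : ρ ≤ r := Nat.div_le_self r L
  have hρR0 : (0 : ℝ) < ρ := by exact_mod_cast hρ1
  have hLR : (0 : ℝ) ≤ L := Nat.cast_nonneg _
  -- L ≤ r/ρ ≤ 2L
  have hratio_ge : (L : ℝ) ≤ (r : ℝ) / ρ := by
    rw [le_div_iff₀ hρR0]
    have : ρ * L ≤ r := Nat.div_mul_le_self r L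
    exact_mod_cast (by simpa [mul_comm] using this)
  have hratio_le : (r : ℝ) / ρ ≤ 2 * L := by
    rw [div_le_iff₀ hρR0]
    have h1 : r < ρ * L + L := by
      have := Nat.lt_div_mul_add (a := r) hL0
      simpa [hρ] using this
    have h2 : ρ * L + L ≤ 2 * L * ρ := by nlinarith
    have h3 : r ≤ 2 * L * ρ := by omega
    exact_mod_cast h3
  have hratio0 : (0 : ℝ) ≤ (r : ℝ) / ρ := by positivity
  -- Step 1: split at the arm event of scale ρ
  have hsplit : P.real (clusterSizeGe (0 : V3) Mr) ≤ P.real {ω | Mr ≤ clusterCapIn (halfBox ρ) ω 0} + armProb (criticalProbI 3) ρ :=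
    real_clusterSizeGe_le_root_add_armProb (criticalProbI 3) ρ Mr
  -- Step 2: (2N+1) Mρ ≤ Mr
  have hN2 : (2 * (N : ℝ) + 1) ≤ c * (L : ℝ) ^ κ := by
    have h0 : 0 ≤ (c * (L : ℝ) ^ κ - 1) / 2 := by linarith
    have := Nat.floor_le h0
    rw [← hN] at this
    linarith
  have hthr : (2 * N + 1) * Mρ ≤ Mr := by
    have hMρ0 : (0 : ℝ) ≤ Mρ := Nat.cast_nonneg _
    have hLκ : (L : ℝ) ^ κ ≤ ((r : ℝ) / ρ) ^ κ := Real.rpow_le_rpow hLR hratio_ge hκ.le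
    have hreal : (2 * (N : ℝ) + 1) * (Mρ : ℝ) ≤ (Mr : ℝ) := by
      calc (2 * (N : ℝ) + 1) * (Mρ : ℝ) ≤ c * (L : ℝ) ^ κ * Mρ := mul_le_mul_of_nonneg_right hN2 hMρ0
        _ ≤ c * ((r : ℝ) / ρ) ^ κ * Mρ :=
            mul_le_mul_of_nonneg_right (mul_le_mul_of_nonneg_left hLκ hc.le) hMρ0
        _ ≤ Mr := hG ρ r hρ1 hρr
    have hcast : (((2 * N + 1) * Mρ : ℕ) : ℝ) ≤ (Mr : ℝ) := by
      push_cast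
      linarith [hreal]
    exact_mod_cast hcast
  -- Step 3: tightness at the confining scale ρ
  have hq : P.real {ω | Mr ≤ clusterCapIn (halfBox ρ) ω 0} ≤
      Real.exp (-(N : ℝ)) * P.real (clusterSizeGe (0 : V3) Mρ) := by
    calc P.real {ω | Mr ≤ clusterCapIn (halfBox ρ) ω 0}
        ≤ P.real {ω | (2 * N + 1) * Mρ ≤ clusterCapIn (halfBox ρ) ω 0} :=
          measureReal_mono (fun ω hω => le_trans hthr hω) (measure_ne_top _ _)
      _ ≤ Real.exp (-(N : ℝ)) * P.real {ω | Mρ ≤ clusterCapIn (halfBox ρ) ω 0} :=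
          real_mul_threshold_le_clusterCapIn_le (criticalProbI 3) le_rfl N
      _ ≤ Real.exp (-(N : ℝ)) * P.real (clusterSizeGe (0 : V3) Mρ) :=
          mul_le_mul_of_nonneg_left (real_le_clusterCapIn_le_real_clusterSizeGe (criticalProbI 3) ρ Mρ)
            (Real.exp_pos _).le
  -- Step 4: the arm at scale ρ
  have harm : armProb (criticalProbI 3) ρ ≤ C * (2 * (L : ℝ)) ^ μ * armProb (criticalProbI 3) r := by
    calc armProb (criticalProbI 3) ρ ≤ C * ((r : ℝ) / ρ) ^ μ * armProb (criticalProbI 3) r := hD ρ r hρ1 hρr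
      _ ≤ C * (2 * (L : ℝ)) ^ μ * armProb (criticalProbI 3) r := by
          gcongr
          · exact armProb_nonneg _ _
  -- combine
  have hπρ : 0 < armProb (criticalProbI 3) ρ := armProb_criticalProbI_pos ρ
  have hvρ0 : 0 ≤ P.real (clusterSizeGe (0 : V3) Mρ) := measureReal_nonneg
  have hE0 : 0 ≤ Real.exp (-(N : ℝ)) := (Real.exp_pos _).le
  set v := P.real (clusterSizeGe (0 : V3) Mρ) with hv
  set πρ := armProb (criticalProbI 3) ρ with hπρdef
  have hkey : P.real (clusterSizeGe (0 : V3) Mr) ≤ πρ * (1 + Real.exp (-(N : ℝ)) * (v / πρ)) := by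
    have h1 : P.real (clusterSizeGe (0 : V3) Mr) ≤ Real.exp (-(N : ℝ)) * v + πρ := by linarith [hsplit, hq]
    have h2 : πρ * (1 + Real.exp (-(N : ℝ)) * (v / πρ)) = Real.exp (-(N : ℝ)) * v + πρ := by
      field_simp
      ring
    linarith [h1, h2]
  have hfac0 : 0 ≤ 1 + Real.exp (-(N : ℝ)) * (v / πρ) := by positivity
  calc P.real (clusterSizeGe (0 : V3) Mr) ≤ πρ * (1 + Real.exp (-(N : ℝ)) * (v / πρ)) := hkey
    _ ≤ C * (2 * (L : ℝ)) ^ μ * armProb (criticalProbI 3) r * (1 + Real.exp (-(N : ℝ)) * (v / πρ)) :=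
        mul_le_mul_of_nonneg_right harm hfac0

/-! ### V ⟸ G ∧ D by induction on the scale -/

/-- **V ⟸ G ∧ D.** Polynomial LOWER growth of the typical max of scale (`G`: `M(Λ_r) ≥ c (r/ρ)^κ M(Λ_ρ)`, `ρ ≤ r`,
some `c, κ > 0`) and polynomial regularity of the wall arm (`D`: `π_s(ρ) ≤ C (r/ρ)^μ π_s(r)`, `ρ ≤ r`, some `C, μ` —
equivalently uniform doubling `π_s(2n) ≥ q₀ π_s(n)` for some `q₀ > 0`) give the wall VOLUME/RADIUS ratio bound
`P^ℍ_{p_c}(|C_ℍ(0)| ≥ typicalMax Λ_r) ≤ K π_s(r)` for all `r ≥ 1`: choose the band ratio `L` by `exists_bandRatio`, and run a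
strong induction on `r` with `volTail_band_step` (`ρ = ⌊r/L⌋ < r`); scales `r < L` are covered by the floor
`π_s(r) ≥ 1/(588 r²)`. [folklore] -/
theorem wallVolumeRadiusRatio_of_growth_of_regular
    (hG : ∃ c κ : ℝ, 0 < c ∧ 0 < κ ∧ ∀ ρ r : ℕ, 1 ≤ ρ → ρ ≤ r →
      c * ((r : ℝ) / ρ) ^ κ * (typicalMax (floorDilutedPercolation 3 (criticalProbI 3) 1) (halfBox ρ) : ℝ) ≤
        typicalMax (floorDilutedPercolation 3 (criticalProbI 3) 1) (halfBox r))
    (hD : ∃ C μ : ℝ, ∀ ρ r : ℕ, 1 ≤ ρ → ρ ≤ r →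
      armProb (criticalProbI 3) ρ ≤ C * ((r : ℝ) / ρ) ^ μ * armProb (criticalProbI 3) r) :
    ∃ K : ℝ, ∀ r : ℕ, 1 ≤ r →
      (floorDilutedPercolation 3 (criticalProbI 3) 1).real
          (clusterSizeGe (0 : V3) (typicalMax (floorDilutedPercolation 3 (criticalProbI 3) 1) (halfBox r))) ≤
        K * armProb (criticalProbI 3) r := by
  obtain ⟨c, κ, hc, hκ, hG⟩ := hG
  obtain ⟨C, μ, hD⟩ := hD
  -- WLOG `μ ≥ 0` and `C ≥ 0` (indeed `C ≥ 1` from `ρ = r = 1`)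
  have hC1 : 1 ≤ C := by
    have h := hD 1 1 le_rfl le_rfl
    have hπ : 0 < armProb (criticalProbI 3) 1 := armProb_criticalProbI_pos 1
    have h' : armProb (criticalProbI 3) 1 ≤ C * armProb (criticalProbI 3) 1 := by
      simpa using h
    nlinarith
  have hC0 : 0 ≤ C := by linarith
  set μ' : ℝ := max μ 0 with hμ'
  have hμ'0 : 0 ≤ μ' := le_max_right _ _
  have hD' : ∀ ρ r : ℕ, 1 ≤ ρ → ρ ≤ r →
      armProb (criticalProbI 3) ρ ≤ C * ((r : ℝ) / ρ) ^ μ' * armProb (criticalProbI 3) r := by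
    intro ρ r hρ hρr
    refine (hD ρ r hρ hρr).trans ?_
    have hρ0 : (0 : ℝ) < ρ := by exact_mod_cast hρ
    have h1 : (1 : ℝ) ≤ (r : ℝ) / ρ := by
      rw [le_div_iff₀ hρ0, one_mul]; exact_mod_cast hρr
    have hpow : ((r : ℝ) / ρ) ^ μ ≤ ((r : ℝ) / ρ) ^ μ' :=
      Real.rpow_le_rpow_of_exponent_le h1 (le_max_left _ _)
    exact mul_le_mul_of_nonneg_right (mul_le_mul_of_nonneg_left hpow hC0) (armProb_nonneg _ _)
  obtain ⟨L, hL2, hcL, hsmall⟩ := exists_bandRatio (C := C) (μ := μ') hc hκ hC0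
  set N : ℕ := ⌊(c * (L : ℝ) ^ κ - 1) / 2⌋₊ with hN
  set A : ℝ := C * (2 * (L : ℝ)) ^ μ' with hA
  have hA0 : 0 ≤ A := by positivity
  have hAsmall : A * Real.exp (-(N : ℝ)) ≤ 1 / 2 := by rw [hA, hN]; exact hsmall
  set B₀ : ℝ := max (588 * (L : ℝ) ^ 2) (2 * A) with hB₀
  have hB₀A : 2 * A ≤ B₀ := le_max_right _ _
  have hB₀L : 588 * (L : ℝ) ^ 2 ≤ B₀ := le_max_left _ _
  have hB₀0 : 0 ≤ B₀ := le_trans (by positivity) hB₀L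
  refine ⟨B₀, fun r => ?_⟩
  -- strong induction on r
  induction r using Nat.strong_induction_on with
  | _ r ih =>
    intro hr
    set P := floorDilutedPercolation 3 (criticalProbI 3) 1 with hP
    have hπr : 0 < armProb (criticalProbI 3) r := armProb_criticalProbI_pos r
    by_cases hrL : r < L
    · -- small scales: v ≤ 1 ≤ 588 r² π_s(r) ≤ 588 L² π_s(r)
      have hv1 : P.real (clusterSizeGe (0 : V3) (typicalMax P (halfBox r))) ≤ 1 := measureReal_le_one
      have hfloor : 1 / (588 * (r : ℝ) ^ 2) ≤ armProb (criticalProbI 3) r := armProb_criticalProbI_ge hr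
      have hr0 : (0 : ℝ) < r := by exact_mod_cast hr
      have h1 : (1 : ℝ) ≤ 588 * (r : ℝ) ^ 2 * armProb (criticalProbI 3) r := by
        have h588 : (0 : ℝ) < 588 * (r : ℝ) ^ 2 := by positivity
        rw [div_le_iff₀' h588] at hfloor
        linarith
      have hrL' : (r : ℝ) ^ 2 ≤ (L : ℝ) ^ 2 := by
        have : (r : ℝ) ≤ L := by exact_mod_cast hrL.le
        nlinarith
      calc P.real (clusterSizeGe (0 : V3) (typicalMax P (halfBox r))) ≤ 1 := hv1
        _ ≤ 588 * (r : ℝ) ^ 2 * armProb (criticalProbI 3) r := h1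
        _ ≤ 588 * (L : ℝ) ^ 2 * armProb (criticalProbI 3) r := by
            exact mul_le_mul_of_nonneg_right (by linarith) hπr.le
        _ ≤ B₀ * armProb (criticalProbI 3) r := mul_le_mul_of_nonneg_right hB₀L hπr.le
    · -- band step + induction hypothesis at ρ = ⌊r/L⌋ < r
      push Not at hrL
      have hL0 : 0 < L := by omega
      have hρ1 : 1 ≤ r / L := Nat.div_pos hrL hL0
      have hρlt : r / L < r := Nat.div_lt_self (by omega) (by omega)
      have hIH := ih (r / L) hρlt hρ1
      have hπρ : 0 < armProb (criticalProbI 3) (r / L) := armProb_criticalProbI_pos (r / L)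
      have hratio : P.real (clusterSizeGe (0 : V3) (typicalMax P (halfBox (r / L)))) / armProb (criticalProbI 3) (r / L) ≤ B₀ := by
        rw [div_le_iff₀ hπρ]; exact hIH
      have hstep := volTail_band_step (C := C) (μ := μ') hc hκ hC0 hμ'0 hG hD' hL2 hcL hrL
      have hE0 : 0 ≤ Real.exp (-(N : ℝ)) := (Real.exp_pos _).le
      calc P.real (clusterSizeGe (0 : V3) (typicalMax P (halfBox r)))
          ≤ A * armProb (criticalProbI 3) r * (1 + Real.exp (-(N : ℝ)) *
              (P.real (clusterSizeGe (0 : V3) (typicalMax P (halfBox (r / L)))) / armProb (criticalProbI 3) (r / L))) := by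
            simpa [hA, hN, hP] using hstep
        _ ≤ A * armProb (criticalProbI 3) r * (1 + Real.exp (-(N : ℝ)) * B₀) := by
            apply mul_le_mul_of_nonneg_left _ (mul_nonneg hA0 hπr.le)
            linarith [mul_le_mul_of_nonneg_left hratio hE0]
        _ = A * armProb (criticalProbI 3) r + (A * Real.exp (-(N : ℝ))) * B₀ * armProb (criticalProbI 3) r := by ring
        _ ≤ A * armProb (criticalProbI 3) r + (1 / 2) * B₀ * armProb (criticalProbI 3) r := by
            have : (A * Real.exp (-(N : ℝ))) * B₀ * armProb (criticalProbI 3) r ≤ (1 / 2) * B₀ * armProb (criticalProbI 3) r :=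
              mul_le_mul_of_nonneg_right (mul_le_mul_of_nonneg_right hAsmall hB₀0) hπr.le
            linarith
        _ ≤ B₀ * armProb (criticalProbI 3) r := by nlinarith [hB₀A, hπr.le, hA0]


/-! ## Glue, part 3: B ⟸ B♯ ∧ V, and the composition from the three stubs -/

/-- **B ⟸ B♯ ∧ V.** The crux `TallClusterMassBound` (by name) from B♯ and the wall volume/radius ratio bound V (stated in route
vocabulary = child `WallVolumeRadiusRatio` of the prepared split): `typicalMax_le_of_noFat`, then ARROW 1 in root-ratio form
(`massBoundAt_of_typicalMax_le_of_rootRatio`, p130878) with `q ≤ P^ℍ(|C_ℍ(0)| ≥ M)` (`real_le_clusterCapIn_le_real_clusterSizeGe`). -/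
theorem tallClusterMassBound_of_noFat_of_volRad :
    (∃ C : ℝ, 0 < C ∧ ∀ n : ℕ, 1 ≤ n → (Literature.Probability.Percolation.floorDilutedPercolation 3 (Literature.Probability.Percolation.criticalProbI 3) 1).real {ω | C * (n : ℝ) ^ ((11 : ℝ) / 4) ≤ (Literature.Probability.Percolation.clusterMaxIn ((Literature.Probability.LatticeModels.box 3 n).filter fun z : Literature.Probability.LatticeModels.Site 3 => 0 ≤ z 0) ω : ℝ)} ≤ Real.exp (-1)) →
    (∃ K : ℝ, ∀ r : ℕ, 1 ≤ r → (Literature.Probability.Percolation.floorDilutedPercolation 3 (Literature.Probability.Percolation.criticalProbI 3) 1).real (Literature.Probability.Percolation.clusterSizeGe (0 : Literature.Probability.LatticeModels.Site 3) (Literature.Probability.Percolation.typicalMax (Literature.Probability.Percolation.floorDilutedPercolation 3 (Literature.Probability.Percolation.criticalProbI 3) 1) ((Literature.Probability.LatticeModels.box 3 r).filter fun z : Literature.Probability.LatticeModels.Site 3 => 0 ≤ z 0))) ≤ K * (Literature.Probability.Percolation.bondPercolation (Literature.Probability.LatticeModels.zdGraph 3) (Literature.Probability.Percolation.criticalProbI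 3)).real {ω | ∃ y : Literature.Probability.LatticeModels.Site 3, (∃ i : Fin 3, (r : ℤ) ≤ |y i|) ∧ ω ∈ Literature.Probability.Percolation.openConnIn {x : Literature.Probability.LatticeModels.Site 3 | 0 ≤ x 0} 0 y}) →
    Summit.CriticalPhenomena.PercolationContinuityZ3.Theses.PercLowPointHalfSpace.TallClusterMassBound := by
  intro hB hV
  obtain ⟨C, hC⟩ := typicalMax_le_of_noFat hB
  obtain ⟨K, hK⟩ := hV
  refine tallClusterMassBound_iff.2 (massBoundAt_of_typicalMax_le_of_rootRatio ((11 : ℝ) / 4) C K hC ?_)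
  intro r hr
  have hq := real_le_clusterCapIn_le_real_clusterSizeGe (criticalProbI 3) r
    (typicalMax (floorDilutedPercolation 3 (criticalProbI 3) 1) (halfBox r))
  exact hq.trans (hK r hr)

/-- **Composition: B ⟸ B♯ ∧ G ∧ D.** The crux `TallClusterMassBound` BY NAME from the statements of the three stubs
(`wallVolumeRadiusRatio_of_growth_of_regular` supplies V from G and D; the route-vocabulary spelling of V is definitionally the
Theorems-vocabulary one: `halfBox r = (box 3 r).filter (0 ≤ ·₀)`, `armProb p r = P_p(arm_ℍ(0,r))`). -/
theorem tallClusterMassBound_of_noFat_of_growth_of_regular :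
    (∃ C : ℝ, 0 < C ∧ ∀ n : ℕ, 1 ≤ n → (Literature.Probability.Percolation.floorDilutedPercolation 3 (Literature.Probability.Percolation.criticalProbI 3) 1).real {ω | C * (n : ℝ) ^ ((11 : ℝ) / 4) ≤ (Literature.Probability.Percolation.clusterMaxIn ((Literature.Probability.LatticeModels.box 3 n).filter fun z : Literature.Probability.LatticeModels.Site 3 => 0 ≤ z 0) ω : ℝ)} ≤ Real.exp (-1)) →
    (∃ c κ : ℝ, 0 < c ∧ 0 < κ ∧ ∀ ρ r : ℕ, 1 ≤ ρ → ρ ≤ r →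
      c * ((r : ℝ) / ρ) ^ κ * (typicalMax (floorDilutedPercolation 3 (criticalProbI 3) 1) (halfBox ρ) : ℝ) ≤
        typicalMax (floorDilutedPercolation 3 (criticalProbI 3) 1) (halfBox r)) →
    (∃ C μ : ℝ, ∀ ρ r : ℕ, 1 ≤ ρ → ρ ≤ r →
      armProb (criticalProbI 3) ρ ≤ C * ((r : ℝ) / ρ) ^ μ * armProb (criticalProbI 3) r) →
    Summit.CriticalPhenomena.PercolationContinuityZ3.Theses.PercLowPointHalfSpace.TallClusterMassBound := by
  intro hB hG hD
  exact tallClusterMassBound_of_noFat_of_volRad hB (wallVolumeRadiusRatio_of_growth_of_regular hG hD)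

/-- **Composition in ROUTE vocabulary: B ⟸ B♯ ∧ G ∧ D** with all three hypotheses spelled with Literature constants only
(`halfBox r` unfolded to `(box 3 r).filter (0 ≤ ·₀)`, `armProb p_c r` unfolded to `(bondPercolation (zdGraph 3) p_c).real
{ω | ∃ y, (∃ i, r ≤ |y i|) ∧ ω ∈ openConnIn {x | 0 ≤ x 0} 0 y}`) — the children `NoFatHalfBoxOrigin`, `TypicalMaxPolyGrowth`,
`WallArmPolyRegular` of the prepared k = 3 route split; definitional unfolding of
`tallClusterMassBound_of_noFat_of_growth_of_regular`. [folklore] -/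
theorem tallClusterMassBound_of_noFat_of_growth_of_regular_route :
    (∃ C : ℝ, 0 < C ∧ ∀ n : ℕ, 1 ≤ n → (Literature.Probability.Percolation.floorDilutedPercolation 3 (Literature.Probability.Percolation.criticalProbI 3) 1).real {ω | C * (n : ℝ) ^ ((11 : ℝ) / 4) ≤ (Literature.Probability.Percolation.clusterMaxIn ((Literature.Probability.LatticeModels.box 3 n).filter fun z : Literature.Probability.LatticeModels.Site 3 => 0 ≤ z 0) ω : ℝ)} ≤ Real.exp (-1)) →
    (∃ c κ : ℝ, 0 < c ∧ 0 < κ ∧ ∀ ρ r : ℕ, 1 ≤ ρ → ρ ≤ r →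
      c * ((r : ℝ) / ρ) ^ κ * (Literature.Probability.Percolation.typicalMax (Literature.Probability.Percolation.floorDilutedPercolation 3 (Literature.Probability.Percolation.criticalProbI 3) 1) ((Literature.Probability.LatticeModels.box 3 ρ).filter fun z : Literature.Probability.LatticeModels.Site 3 => 0 ≤ z 0) : ℝ) ≤
        Literature.Probability.Percolation.typicalMax (Literature.Probability.Percolation.floorDilutedPercolation 3 (Literature.Probability.Percolation.criticalProbI 3) 1) ((Literature.Probability.LatticeModels.box 3 r).filter fun z : Literature.Probability.LatticeModels.Site 3 => 0 ≤ z 0)) →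
    (∃ C μ : ℝ, ∀ ρ r : ℕ, 1 ≤ ρ → ρ ≤ r →
      (Literature.Probability.Percolation.bondPercolation (Literature.Probability.LatticeModels.zdGraph 3) (Literature.Probability.Percolation.criticalProbI 3)).real {ω | ∃ y : Literature.Probability.LatticeModels.Site 3, (∃ i : Fin 3, (ρ : ℤ) ≤ |y i|) ∧ ω ∈ Literature.Probability.Percolation.openConnIn {x : Literature.Probability.LatticeModels.Site 3 | 0 ≤ x 0} 0 y} ≤
        C * ((r : ℝ) / ρ) ^ μ * (Literature.Probability.Percolation.bondPercolation (Literature.Probability.LatticeModels.zdGraph 3) (Literature.Probability.Percolation.criticalProbI 3)).real {ω | ∃ y : Literature.Probability.LatticeModels.Site 3, (∃ i : Fin 3, (r : ℤ) ≤ |y i|) ∧ ω ∈ Literature.Probability.Percolation.openConnIn {x : Literature.Probability.LatticeModels.Site 3 | 0 ≤ x 0} 0 y}) →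
    Summit.CriticalPhenomena.PercolationContinuityZ3.Theses.PercLowPointHalfSpace.TallClusterMassBound :=
  fun hB hG hD => tallClusterMassBound_of_noFat_of_growth_of_regular hB hG hD

end Summit.CriticalPhenomena.PercolationContinuityZ3.Theorems.TallClusterMassBound.OnesidedHalves

end
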